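import Mathlib.FieldTheory.AlgebraicClosure
import Mathlib.RingTheory.AlgebraicIndependent.Transcendental
import Mathlib.Topology.MetricSpace.Pseudo.Pi
import Literature.ModelTheory.ExponentialFields.SemialgebraicInterior
import Literature.NumberTheory.Transcendental.KZCalculusOver
import Summits.KontsevichZagierPeriods.KontsevichZagierPeriods.Theses.DefinableMoves

/-!
# Route DefinableMoves — `AlgebraicPoints` (item stmt-KontsevichZagierPeriods-4090)

`ℝ_alg ≺ ℝ`, existential case: **a nonempty `ℚ`-semialgebraic subset of `ℝⁿ` contains a point all of
whose coordinates are algebraic over `ℚ`** (Tarski–Seidenberg transfer: Basu–Pollack–Roy 2006,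
§2.5.1, Thm. 2.80; Bochnak–Coste–Roy 1998, Ch. 5, transfer principle).

Proof (elementary given the tree's Tarski–Seidenberg theorem with coefficients in an arbitrary
subring of `ℝ`). Work with the coefficient field `K = algebraicClosure ℚ ℝ ⊆ ℝ` (the real algebraic
numbers) and prove, by induction on `n`, that every nonempty `K`-semialgebraic `S ⊆ ℝⁿ` has a point in
`Kⁿ`:
* project `S` to `ℝⁿ⁻¹` (`tarski_seidenberg_real_holds (k := K)`), pick a `K`-point `a` of the
  projection by induction, and look at the fibre `{t | (a, t) ∈ S} ⊆ ℝ¹`, which is `K`-semialgebraic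
  (substitute the constants `aᵢ ∈ K` into the defining polynomials: `IsSemialgebraic.preimage_aeval`);
* in dimension one, write the set by sign conditions on finitely many `q ∈ K[X]`
  (`IsSemialgebraic.exists_eq_setOf_signVec_mem`) and take a point `u₀` of it: either `u₀` is a root of
  a non-zero `q`, hence algebraic over `K`, hence in `K` (`K` is relatively algebraically closed in `ℝ`),
  or all non-zero `q` keep their (non-zero) sign near `u₀`, so the sign cell of `u₀` is an open subset
  of the set and contains a rational point.
Finally `ℚ`-semialgebraic sets are `K`-semialgebraic (`IsSemialgebraic.baseChange`).
-/

noncomputable section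

namespace Summit.KontsevichZagierPeriods.DefinableMoves

open Set MvPolynomial
open Literature.ModelTheory.ExponentialFields

/-- **Dimension one.** A nonempty subset of `ℝ¹` which is semialgebraic over the field
`K = algebraicClosure ℚ ℝ` of real algebraic numbers contains a point with coordinate in `K`:
by the sign-condition normal form, a point `u₀` of the set is either a root of a non-zero
polynomial over `K` (then `u₀ ∈ K`, `K` being relatively algebraically closed in `ℝ`) or an interior
point of its sign cell, which then contains a rational point. -/
theorem exists_mem_algebraicClosure_of_fin_one {T : Set (Fin 1 → ℝ)}
    (hT : IsSemialgebraic (algebraicClosure ℚ ℝ) T) (hne : T.Nonempty) :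
    ∃ u ∈ T, ∀ j, u j ∈ algebraicClosure ℚ ℝ := by
  classical
  obtain ⟨Q, Sg, rfl⟩ := hT.exists_eq_setOf_signVec_mem
  obtain ⟨u₀, hu₀⟩ := hne
  by_cases hA : ∃ q ∈ Q, q ≠ 0 ∧ aeval u₀ q = 0
  · -- `u₀ 0` is a root of a non-zero polynomial over `K`, hence algebraic over `K`, hence over `ℚ`
    obtain ⟨q, -, hq0, hqu⟩ := hA
    have hnot : ¬ AlgebraicIndependent (algebraicClosure ℚ ℝ) u₀ := fun hind =>
      hq0 (hind (by rw [hqu, map_zero]))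
    rw [algebraicIndependent_unique_type_iff] at hnot
    have halgK : IsAlgebraic (algebraicClosure ℚ ℝ) (u₀ default) := by
      by_contra h
      exact hnot h
    haveI : Algebra.IsAlgebraic ℚ (algebraicClosure ℚ ℝ) := algebraicClosure.isAlgebraic ℚ ℝ
    have halg : IsAlgebraic ℚ (u₀ default) := halgK.restrictScalars ℚ
    refine ⟨u₀, hu₀, fun j => ?_⟩
    rw [Subsingleton.elim j default]
    exact mem_algebraicClosure_iff.2 halg
  · -- every non-zero `q ∈ Q` is non-zero at `u₀`: the sign cell of `u₀` is open
    push Not at hA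
    set V : Set (Fin 1 → ℝ) :=
      {u | ∀ q ∈ Q, SignType.sign (aeval u q) = SignType.sign (aeval u₀ q)} with hV
    have hVT : V ⊆ {x | (fun q : Q => SignType.sign
        (aeval x (q : MvPolynomial (Fin 1) (algebraicClosure ℚ ℝ)))) ∈ Sg} := by
      intro u hu
      have heq : (fun q : Q => SignType.sign
          (aeval u (q : MvPolynomial (Fin 1) (algebraicClosure ℚ ℝ)))) =
          fun q : Q => SignType.sign
            (aeval u₀ (q : MvPolynomial (Fin 1) (algebraicClosure ℚ ℝ))) :=
        funext fun q => hu q q.2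
      show _ ∈ Sg
      rw [heq]
      exact hu₀
    have hVopen : IsOpen V := by
      have hVeq : V = ⋂ q ∈ Q, {u | SignType.sign (aeval u q) = SignType.sign (aeval u₀ q)} := by
        ext u
        simp [hV]
      rw [hVeq]
      refine isOpen_biInter_finset fun q hq => ?_
      by_cases hq0 : q = 0
      · subst hq0
        simp
      · rcases lt_or_gt_of_ne (hA q hq hq0) with hneg | hpos
        · rw [sign_neg hneg]
          simp only [sign_eq_neg_one_iff]
          exact isOpen_lt (continuous_aeval_real q) continuous_const
        · rw [sign_pos hpos]
          simp only [sign_eq_one_iff]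
          exact isOpen_lt continuous_const (continuous_aeval_real q)
    have hu₀V : u₀ ∈ V := fun q _ => rfl
    obtain ⟨ε, hε, hball⟩ := Metric.isOpen_iff.1 hVopen u₀ hu₀V
    obtain ⟨r, hr₁, hr₂⟩ := exists_rat_btwn (show u₀ 0 - ε < u₀ 0 + ε by linarith)
    refine ⟨fun _ => (r : ℝ), hVT (hball ?_), fun _ => ?_⟩
    · rw [Metric.mem_ball, dist_pi_lt_iff hε]
      intro b
      rw [Subsingleton.elim b 0, Real.dist_eq, abs_sub_lt_iff]
      constructor <;> linarith
    · have h : (algebraMap ℚ ℝ r) ∈ algebraicClosure ℚ ℝ := (algebraicClosure ℚ ℝ).algebraMap_mem r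
      rwa [eq_ratCast] at h

/-- **All dimensions, coefficients in `K = algebraicClosure ℚ ℝ`.** Every nonempty `K`-semialgebraic
subset of `ℝⁿ` contains a point of `Kⁿ`: induction on `n`, projecting with Tarski–Seidenberg over the
coefficient ring `K` (`tarski_seidenberg_real_holds`), choosing a `K`-point of the projection, and
applying the one-dimensional case to the fibre, which is `K`-semialgebraic by substitution of the
constants `aᵢ ∈ K` (`IsSemialgebraic.preimage_aeval`). -/
theorem exists_mem_algebraicClosure (n : ℕ) (S : Set (Fin n → ℝ))
    (hS : IsSemialgebraic (algebraicClosure ℚ ℝ) S) (hne : S.Nonempty) :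
    ∃ x ∈ S, ∀ i, x i ∈ algebraicClosure ℚ ℝ := by
  induction n with
  | zero =>
    obtain ⟨x, hx⟩ := hne
    exact ⟨x, hx, fun i => i.elim0⟩
  | succ n ih =>
    obtain ⟨y, hy⟩ := hne
    -- a `K`-point of the projection forgetting the last coordinate
    have hπ := tarski_seidenberg_real_holds (k := algebraicClosure ℚ ℝ) hS
    obtain ⟨a, ⟨z, hz, rfl⟩, ha⟩ := ih _ hπ ⟨_, y, hy, rfl⟩
    -- the fibre over it, as the preimage of `S` under a polynomial map `ℝ¹ → ℝⁿ⁺¹` over `K`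
    set P : Fin (n + 1) → MvPolynomial (Fin 1) (algebraicClosure ℚ ℝ) :=
      Fin.snoc (fun i => C ⟨z (Fin.castSucc i), ha i⟩) (X 0) with hPdef
    have hP : ∀ u : Fin 1 → ℝ,
        (fun j => aeval u (P j)) = Fin.snoc (fun i => z (Fin.castSucc i)) (u 0) := by
      intro u
      funext j
      refine Fin.lastCases ?_ (fun i => ?_) j
      · simp [hPdef, Fin.snoc_last]
      · simp only [hPdef, Fin.snoc_castSucc, aeval_C]
        rfl
    have hF : IsSemialgebraic (algebraicClosure ℚ ℝ)
        ((fun u : Fin 1 → ℝ => fun j => aeval u (P j)) ⁻¹' S) := hS.preimage_aeval P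
    have hFne : ((fun u : Fin 1 → ℝ => fun j => aeval u (P j)) ⁻¹' S).Nonempty := by
      refine ⟨fun _ => z (Fin.last n), ?_⟩
      show (fun j => aeval (fun _ : Fin 1 => z (Fin.last n)) (P j)) ∈ S
      rw [hP]
      convert hz using 1
      exact Fin.snoc_init_self z
    obtain ⟨u, hu, huK⟩ := exists_mem_algebraicClosure_of_fin_one hF hFne
    refine ⟨_, hu, fun i => ?_⟩
    show (fun j => aeval u (P j)) i ∈ algebraicClosure ℚ ℝ
    rw [hP]
    refine Fin.lastCases ?_ (fun j => ?_) i
    · rw [Fin.snoc_last]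
      exact huK 0
    · rw [Fin.snoc_castSucc]
      exact ha j

/-- **`AlgebraicPoints`** (route DefinableMoves, item stmt-KontsevichZagierPeriods-4090): a nonempty
`ℚ`-semialgebraic subset of `ℝⁿ` contains a point all of whose coordinates are algebraic over `ℚ`
(`ℝ_alg ≺ ℝ`, existential case; Basu–Pollack–Roy 2006, §2.5.1, Thm. 2.80; Bochnak–Coste–Roy 1998,
Ch. 5). From `exists_mem_algebraicClosure` after the base change `ℚ → algebraicClosure ℚ ℝ` of
coefficients. -/
theorem algebraicPoints_proof :
    Summit.KontsevichZagierPeriods.KontsevichZagierPeriods.Theses.DefinableMoves.AlgebraicPoints := by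
  intro n S hS hne
  obtain ⟨x, hx, hxK⟩ :=
    exists_mem_algebraicClosure n S (hS.baseChange (algebraicClosure ℚ ℝ)) hne
  exact ⟨x, hx, fun i => mem_algebraicClosure_iff.1 (hxK i)⟩

end Summit.KontsevichZagierPeriods.DefinableMoves

end
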